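import Summits.CriticalPhenomena.PercolationContinuityZ3.Theorems.Transplant.PlanarCells2VDefs
import HarnessLib

/-!
# N2 (frames-only node `SamePDropOfSkeletonFrm₁`, OPEN) — (R-44)(c)/(R-48) DESIGN W, planar part: **THE FACE WINDOW OF THE STAGGERED CELLS WITH
# ASYMMETRIC ROOMS** (`PCells2V.faceSh / faceCen / faceExt` and their rows; hp-8 g43; split out of `SkelPhiFaceDataNV` §1 on p1-g18's ask
# 2026-08-23T16:36:26Z so that F-K1 part 2 V (`SkelFrmBFaceFrameRowsV`, `kFF₂V_le_lin`) can land before the V3 wave)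

The face window over the face row `F^{j+1}` of a step `du` is centred on the ASYMMETRIC transverse room `σ·[−hB∥, hF∥]` of `PCells2V`:
`faceSh du := σ·⌊(hF∥ − hB∥)/2⌋`, `faceCen x du j := (faceLo on the axis, cenS + faceSh across)`, `faceExt du := (0, ⌈(hB∥ + hF∥)/2⌉)`;
rows: `faceCen_apply_fst/_oth`, `abs_faceSh_le` (`|faceSh| ≤ r⊥`), `faceSh_mem_room`, `faceExt_oth_le` (`≤ 2r⊥`), `faceLo_fst_eq_faceHi_fst`,
`eq_faceCen_fst_of_mem_faceRow`, `abs_sub_faceCen_le`, `faceCen_mem_faceRow`. Pure planar geometry over `PlanarCells2VDefs`.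
builds on p205010 (kernel theorem, internal audit signed; external expert review pending) — nothing here uses p205010; NOTHING is claimed about the
open node `SamePDropOfSkeletonFrm₁`.
Lane `prim-bschramm`, seat `prim-hp-8` (gen 43); helper file (`--supports stmt-CriticalPhenomena-4575 --as helper`).
[cite: KozmaNitzan2024, §4 p. 26 (Q_v, E_{v,x}), Lemma 12 (p. 24)] [cite: MartineauTassion2017, §4.1]
-/

noncomputable section

open scoped Classical

namespace Summit.CriticalPhenomena.PercolationContinuityZ3.Theorems

namespace Transplant

open Literature.Probability.Percolation Literature.Probability.LatticeModels SimpleGraph GadgetSystem Contour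
open Literature.Probability.Percolation.KozmaNitzan
open Literature.Probability.Percolation.KozmaNitzan.Cells (oth oth_ne sgOf sgOf_sign stepVec_apply_fst stepVec_apply_oth eq_oth_of_ne oth_oth)
open PCells (mem_psBox_iff)

/-! ## §1 Planar: the centre of the shifted face row and its extents -/

namespace PCells2V

variable (P : PCells2V)

/-- **The transverse SHIFT of the face-window centre** (DESIGN W, one-sided face route (R-44)(c), hp-8 g43): `σ·⌊(hF∥ − hB∥)/2⌋` — the window is centred
on the ASYMMETRIC room `σ·[−hB∥, hF∥]`, so its kit centres overshoot the column centre forward by ≤ `hF∥` + level spread; `0` when `hB = hF`. [this work] -/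
def faceSh (du : MDir) : ℤ := sgOf du * (((P.hF du.1 : ℤ) - P.hB du.1) / 2)

/-- **The centre point of the face window over the face row `F^{j+1}`**: the face level on the axis, the column centre shifted by `faceSh`. [this work] -/
def faceCen (x : Site 2) (du : MDir) (j : ℕ) : Site 2 := fun k => if k = du.1 then P.faceLo x du j k else P.cenS x k + P.faceSh du

/-- **The extents of the face row about the window centre**: `0` along the axis, `⌈(hB∥ + hF∥)/2⌉` across. [this work] -/
def faceExt (du : MDir) : Site 2 := fun k => if k = du.1 then 0 else ((P.hB du.1 : ℤ) + P.hF du.1 + 1) / 2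

/-- `faceCen` on the axis. [folklore] -/
theorem faceCen_apply_fst (x : Site 2) (du : MDir) (j : ℕ) : (((P : PCells2V).faceCen x du j du.1 = P.faceLo x du j du.1) : Prop) := by simp [faceCen]

/-- `faceCen` across: the shifted column centre. [folklore] -/
theorem faceCen_apply_oth (x : Site 2) (du : MDir) (j : ℕ) : (P : PCells2V).faceCen x du j (oth du.1) = P.cenS x (oth du.1) + P.faceSh du := by
  simp [faceCen, oth_ne]

/-- The shift is at most `r⊥` (`hB, hF ≤ 2r⊥`). [folklore] -/
theorem abs_faceSh_le (du : MDir) : |(P : PCells2V).faceSh du| ≤ (P.r (oth du.1) : ℤ) := by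
  have h1 := P.hB_le' du.1; have h2 := P.hF_le' du.1; have h3 : (0 : ℤ) ≤ P.hB du.1 := Nat.cast_nonneg _
  have h4 : (0 : ℤ) ≤ P.hF du.1 := Nat.cast_nonneg _
  unfold faceSh; rcases sgOf_sign du with hs | hs <;> rw [hs] <;> refine abs_le.2 ⟨?_, ?_⟩ <;> omega

/-- The signed shift lies in the room: `−hB ≤ ⌊(hF − hB)/2⌋ ≤ hF`. [folklore] -/
theorem faceSh_mem_room (du : MDir) : -(P.hB du.1 : ℤ) ≤ sgOf du * (P : PCells2V).faceSh du ∧ sgOf du * P.faceSh du ≤ P.hF du.1 := by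
  have h3 : (0 : ℤ) ≤ P.hB du.1 := Nat.cast_nonneg _; have h4 : (0 : ℤ) ≤ P.hF du.1 := Nat.cast_nonneg _
  unfold faceSh; rcases sgOf_sign du with hs | hs <;> rw [hs] <;> constructor <;> omega

/-- The transverse extent is at most KN's `2r⊥` (so T's frame-room rows `haw` serve a fortiori). [folklore] -/
theorem faceExt_oth_le (du : MDir) : (P : PCells2V).faceExt du (oth du.1) ≤ 2 * (P.r (oth du.1) : ℤ) := by
  have h1 := P.hB_le' du.1; have h2 := P.hF_le' du.1
  simp only [faceExt, if_neg (oth_ne du.1)]; omega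

/-- The face row has extent `0` along the axis: `faceLo du.1 = faceHi du.1`. [folklore] -/
theorem faceLo_fst_eq_faceHi_fst (x : Site 2) (du : MDir) (j : ℕ) : (((P : PCells2V).faceLo x du j du.1 = P.faceHi x du j du.1) : Prop) := by
  simp only [faceLo, faceHi, sLoA, sHiA, if_true]

/-- A point of the face row has the face level on the axis. [folklore] -/
theorem eq_faceCen_fst_of_mem_faceRow {x : Site 2} {du : MDir} {j : ℕ} {t : Site 2}
    (ht : t ∈ Finset.Icc ((P : PCells2V).faceLo x du j) (P.faceHi x du j)) : ((t du.1 = P.faceCen x du j du.1) : Prop) := by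
  rw [faceCen_apply_fst]; rw [Finset.mem_Icc] at ht
  have h1 := ht.1 du.1; have h2 := ht.2 du.1
  rw [← faceLo_fst_eq_faceHi_fst] at h2; exact le_antisymm h2 h1

/-- A point of the face row is within `faceExt` of the window centre in every coordinate. [folklore] -/
theorem abs_sub_faceCen_le {x : Site 2} {du : MDir} {j : ℕ} {t : Site 2} (ht : t ∈ Finset.Icc ((P : PCells2V).faceLo x du j) (P.faceHi x du j))
    (k : Fin 2) : ((|t k - P.faceCen x du j k| ≤ P.faceExt du k) : Prop) := by
  by_cases hk : k = du.1
  · subst hk; rw [P.eq_faceCen_fst_of_mem_faceRow ht, sub_self, abs_zero]; simp [faceExt]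
  · rw [eq_oth_of_ne hk, faceCen_apply_oth]
    rw [Icc_faceLo_faceHi, mem_psBoxA_iff] at ht
    obtain ⟨-, h3, h4⟩ := ht
    simp only [faceExt, if_neg (oth_ne du.1)]
    have h5 : (0 : ℤ) ≤ P.hB du.1 := Nat.cast_nonneg _; have h6 : (0 : ℤ) ≤ P.hF du.1 := Nat.cast_nonneg _
    unfold faceSh; rcases sgOf_sign du with hs | hs <;> rw [hs] at h3 h4 ⊢ <;> refine abs_le.2 ⟨?_, ?_⟩ <;> omega

/-- The window centre lies in the face row. [folklore] -/
theorem faceCen_mem_faceRow (x : Site 2) (du : MDir) (j : ℕ) : (((P : PCells2V).faceCen x du j ∈ Finset.Icc (P.faceLo x du j) (P.faceHi x du j)) : Prop) := by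
  rw [Icc_faceLo_faceHi, mem_psBoxA_iff]
  have hm := P.faceSh_mem_room du
  refine ⟨⟨?_, ?_⟩, ?_, ?_⟩
  · rw [faceCen_apply_fst]; simp only [faceLo, sLoA, if_true]
    rcases sgOf_sign du with hs | hs <;> simp only [hs, if_true, show (-1 : ℤ) ≠ 1 by norm_num, if_false] <;> linarith
  · rw [faceCen_apply_fst]; simp only [faceLo, sLoA, if_true]
    rcases sgOf_sign du with hs | hs <;> simp only [hs, if_true, show (-1 : ℤ) ≠ 1 by norm_num, if_false] <;> linarith
  · rw [faceCen_apply_oth, add_sub_cancel_left]; exact hm.1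
  · rw [faceCen_apply_oth, add_sub_cancel_left]; exact hm.2

end PCells2V

end Transplant

end Summit.CriticalPhenomena.PercolationContinuityZ3.Theorems

end
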